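import Summits.QuantumFields.YangMills.Theorems.FluctuationComparisonRegPrIntLS2BetaGaugeTransitionStep
import Summits.QuantumFields.YangMills.Theorems.FluctuationComparisonRegPrIntLS2BetaClosedBlockAxialGauge
import Summits.QuantumFields.YangMills.Theorems.FluctuationComparisonRegPrIntLS2BetaSqrtGaugeGlue
import Summits.QuantumFields.YangMills.Theorems.FluctuationComparisonRegPrIntLS2BetaSmallBondGaugeToronObstruction
import Summits.QuantumFields.YangMills.Theorems.FluctuationComparisonRegPrIntLS2BetaParityBlockPartitionOddEq
import HarnessLib

/-!
# S2β · D-GUARD ∕ (BG∞) — THE ASSEMBLY, ODD-EQUAL EDITION («ROUTE SQ», UV3-NODE §116 ADD.2): `hBG_of_sections_oddEq (hSec₂) : ∃ C c, 0 ≤ C ∧ ⟨LEAD №41's `hBG` letter,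
# byte for byte⟩` where `hSec₂` = the sections hypothesis `hSec` of ✓`hBG_of_sections` PLUS ONE LAW on the block data — all odd-indexed blocks have equal length —
# so that the (L-Σ) prover may feed SQUARE slices and CUBIC blocks to the landed square∕cube filling files (T0∕T1∕T2∕(L-T), S0∕S1∕S2∕(L-S))

Cell `ym3-torus` (YM ladder rung R3 = continuum `SU(2)` Yang–Mills on the three-torus at fixed lattice data — a RUNG: NOT d = 4, NOT infinite volume,
NOT a mass gap, NOT Clay).  Width seat «width 19» `ym3-torus-px19` (gen 25, ★p1 lineage), FREE px helper on crux `stmt-QuantumFields-20520`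
(`FluctuationComparisonRegPrIntL`; registry `Lines/semiclassical_s2beta.lean` UNTOUCHED, 0∕5); `--kind proof --supports stmt-QuantumFields-20520 --as helper`,
count-neutral, DEFINITION-FREE (0 `def`, 0 `instance`, 0 `notation`, 0 `sorry`, default heartbeats).  (BG∞) plan of record: UV3-NODE §116 + ADD.1 + ADD.2
(architect ruling px17 g23 2026-09-01T00:13:02Z; desk RULINGs №123, №127 binder style; LEAD RULING №66).

WHY (ADD.2, rectangle caveat ∕ «ROUTE SQ»).  Block-data text v1 (✓`exists_parityBlocks`) lets the three sides `len (Q κ)` of a parity block differ by one independently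
per axis, while the landed filling files are square∕cube (`n × n (× n)`).  In the descent formulation only ODD-indexed intervals are ever the sides of a filled square
(stage 2) or cube (stage 3).  Block-data text v2 (✓`exists_parityBlocks_oddEq`, this seat) adds the law `∀ i i′, i odd → i′ odd → len i = len i′`; this file is
✓`hBG_of_sections` re-run on text v2: the SAME conclusion from the WEAKER hypothesis `hSec₂` (= `hSec` with that law available to the sections prover).  The proof is
✓p840037's, verbatim but for the partition lemma and the one extra argument passed to `hSec₂`; v1 stays valid and is not touched.

WHAT IS PROVED (sorry-free).  ★★★ `hBG_of_sections_oddEq` — `hSec₂ → ∃ C c, 0 ≤ C ∧ ⟨hBG letter⟩` with the same constants as v1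
(`C := max (32π, (π∕2)(10∕32 + 64K))`, `c := max (7π, 8πK)`, `ρ′ := min (⌊1∕(32√θ)⌋, ⌊N∕8⌋)`).

HONEST SCOPE.  An ASSEMBLY over a displayed hypothesis: `hSec₂` = (L-Σ) of UV3-NODE §116 ADD.1∕ADD.2 — UNPROVED here and displayed, not hidden.  Consequently
`hBG`, (BG∞), `hsupp⁺`, D-GUARD's two `hsupp` letters are NOT proved by this file.  Nothing of Bałaban's renormalisation-group analysis is asserted or proved
([Balaban1985RegularSpaces] Lemma 1 p.79 ∕ (1.29) p.81 and [Balaban1985UV3] (8) p.18 are the local, non-uniform statements in print; the N-uniform torus bound is the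
(BG∞) plan's conjecture, NOT in print).  GAP♯∘ (`stub_uniformFibreGapOrbit`, registry UNTOUCHED), the five registered stubs (0∕5), S2β, 20520, 19936, 19200,
`YM3TorusSU2` are NOT proved; no registered stub is closed; rung R3 — NOT d = 4, NOT infinite volume, NOT a mass gap, NOT Clay; the Yang–Mills mass gap is NOT
proved.  Axioms standard.

References: T. Bałaban, CMP **99** (1985) 75–102 [Balaban1985RegularSpaces]; CMP **102** (1985) 255–275 [Balaban1985UV3].
-/

set_option autoImplicit false

noncomputable section

namespace Summit.QuantumFields.YangMills.Theorems.FluctuationComparisonRegPrIntLS2BetaSqrtGaugeAssemblyOfSectionsOddEq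

open scoped Real
open Literature.MathematicalPhysics.QuantumLattice (su2Quat)
open Literature.MathematicalPhysics.QuantumFieldTheory.Balaban1983to89
open T4CubeChartGnomonic (SU2)
open T4ExpWindowSmallField (logVec norm_logVec_le_pi)
open T3ContinuumYM3Torus (T3Family)
open B10Eq27TorusAxialLog (axialT)
open Summit.QuantumFields.YangMills.Theorems.FluctuationComparisonRegPrIntLS2BetaGaugeTransitionStep (dist1_transition_step_le_two_mul)
open Summit.QuantumFields.YangMills.Theorems.FluctuationComparisonRegPrIntLS2BetaClosedBlockAxialGauge (dist1_gaugeAct_axialT_le_of_closedBlock_rho)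
open Summit.QuantumFields.YangMills.Theorems.FluctuationComparisonRegPrIntLS2BetaParityBlockPartitionOddEq (exists_parityBlocks_oddEq)
open Summit.QuantumFields.YangMills.Theorems.FluctuationComparisonRegPrIntLS2BetaSqrtGaugeGlue (norm_logVec_glue_le_of_bounds)

/-- ★★★ **`hBG` FROM THE ODD-EQUAL SECTIONS HYPOTHESIS `hSec₂`** (binder style, block-data text v2; the final assembly of the (BG∞) road modulo (L-Σ)): regimes
`θ > 1∕1024` ∕ `N ≤ 7` by the trivial gauge, else the gluing at `ρ′ := min(⌊1∕(32√θ)⌋, ⌊N∕8⌋)` — odd-equal parity blocks (✓`exists_parityBlocks_oddEq`), corner axial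
gauges (✓p839309), transitions (✓p838762), `hSec₂`, glue (✓p839733); the proof of ✓`hBG_of_sections` with one more law threaded.
[cite: Balaban1985RegularSpaces, Lemma 1 p.79, Thm 2 p.83; Balaban1985UV3, (1)-(3) p.256] -/
theorem hBG_of_sections_oddEq
    (hSec : ∃ K : ℝ, 0 ≤ K ∧ ∀ (P : Params), P.d = 3 → ∀ (ρ : ℕ), 1 ≤ ρ → 8 * ρ ≤ P.sitesPerDir 0 →
      ∀ (M : ℕ) (len start : Fin M → ℕ) (owner : ZMod (P.sitesPerDir 0) → Fin M),
        Even M → 8 ≤ M → (∀ i, ρ ≤ len i ∧ 3 * len i ≤ 4 * ρ + 3) → (∀ i : Fin M, (i : ℕ) = 0 → start i = 0) →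
        (∀ i j : Fin M, (j : ℕ) = (i : ℕ) + 1 → start j = start i + len i) → (∀ i : Fin M, (i : ℕ) + 1 = M → start i + len i = P.sitesPerDir 0) →
        (∀ v : ZMod (P.sitesPerDir 0), start (owner v) ≤ v.val ∧ v.val < start (owner v) + len (owner v)) →
        (∀ i i' : Fin M, (i : ℕ) % 2 = 1 → (i' : ℕ) % 2 = 1 → len i = len i') →
      ∀ (g : (Fin P.d → Fin M) → Site P 0 → SU2) (η : ℝ), η * ρ ≤ 1 / 40 →
        (∀ (Q Q' : Fin P.d → Fin M) (b : PBond P 0),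
          (∀ κ, (b.src κ - ((start (Q κ) : ℕ) : ZMod (P.sitesPerDir 0))).val ≤ len (Q κ)) →
          (∀ κ, (b.tgt κ - ((start (Q κ) : ℕ) : ZMod (P.sitesPerDir 0))).val ≤ len (Q κ)) →
          (∀ κ, (b.src κ - ((start (Q' κ) : ℕ) : ZMod (P.sitesPerDir 0))).val ≤ len (Q' κ)) →
          (∀ κ, (b.tgt κ - ((start (Q' κ) : ℕ) : ZMod (P.sitesPerDir 0))).val ≤ len (Q' κ)) →
          dist1 ((g Q b.src * (g Q' b.src)⁻¹)⁻¹ * (g Q b.tgt * (g Q' b.tgt)⁻¹)) ≤ η) →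
        ∃ w : (Fin P.d → Fin M) → Site P 0 → SU2,
          (∀ (Q Q' : Fin P.d → Fin M) (x : Site P 0),
            (∀ κ, (x κ - ((start (Q κ) : ℕ) : ZMod (P.sitesPerDir 0))).val ≤ len (Q κ)) →
            (∀ κ, (x κ - ((start (Q' κ) : ℕ) : ZMod (P.sitesPerDir 0))).val ≤ len (Q' κ)) →
            w Q x * g Q x = w Q' x * g Q' x) ∧
          (∀ (Q : Fin P.d → Fin M) (b : PBond P 0),
            (∀ κ, (b.src κ - ((start (Q κ) : ℕ) : ZMod (P.sitesPerDir 0))).val ≤ len (Q κ)) →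
            (∀ κ, (b.tgt κ - ((start (Q κ) : ℕ) : ZMod (P.sitesPerDir 0))).val ≤ len (Q κ)) →
            dist1 (w Q b.src * (w Q b.tgt)⁻¹) ≤ K / ρ)) :
    ∃ C c : ℝ, 0 ≤ C ∧ ∀ (F : T3Family) (J : ℕ) (θ : ℝ), 0 < θ → ∀ V : GaugeField (F.P J) 0 (Matrix.specialUnitaryGroup (Fin 2) ℂ), PlaqSmall θ V →
      ∃ u : GaugeTransf (F.P J) 0 (Matrix.specialUnitaryGroup (Fin 2) ℂ),
        ∀ e, ‖logVec (su2Quat (GaugeField.gaugeAct u V e))‖ ≤ C * Real.sqrt θ + c / (((F.P J).sitesPerDir 0 : ℕ) : ℝ) := by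
  obtain ⟨K, hK0, hSec⟩ := hSec
  have hπ := Real.pi_pos
  obtain ⟨C, hC32, hCL⟩ : ∃ C : ℝ, 32 * π ≤ C ∧ π / 2 * (10 / 32 + 64 * K) ≤ C :=
    ⟨max (32 * π) (π / 2 * (10 / 32 + 64 * K)), le_max_left _ _, le_max_right _ _⟩
  obtain ⟨c, hc7, hcK⟩ : ∃ c : ℝ, 7 * π ≤ c ∧ 8 * π * K ≤ c := ⟨max (7 * π) (8 * π * K), le_max_left _ _, le_max_right _ _⟩
  have hC0 : 0 ≤ C := by linarith
  have hc0 : 0 ≤ c := by linarith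
  refine ⟨C, c, hC0, fun F J θ hθ V hV => ?_⟩
  set N : ℕ := (F.P J).sitesPerDir 0 with hNdef
  have hNpos : 0 < N := Nat.pos_of_ne_zero ((F.P J).sitesPerDir_ne_zero 0)
  have hNr : (0 : ℝ) < (N : ℝ) := by exact_mod_cast hNpos
  have hsq0 : 0 ≤ Real.sqrt θ := Real.sqrt_nonneg θ
  have hcN : 0 ≤ c / (N : ℝ) := div_nonneg hc0 hNr.le
  have hCs0 : 0 ≤ C * Real.sqrt θ := mul_nonneg hC0 hsq0
  have h32 : (1 : ℝ) / 32 = Real.sqrt ((1 / 32) ^ 2) := by rw [Real.sqrt_sq (by norm_num)]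
  have harcπ : ∀ (u : GaugeTransf (F.P J) 0 SU2) e, ‖logVec (su2Quat (GaugeField.gaugeAct u V e))‖ ≤ π := fun u e => norm_logVec_le_pi _
  by_cases hbig : (1 : ℝ) / 1024 < θ
  · -- REGIME A: the trivial gauge, `π ≤ 32π√θ`
    refine ⟨fun _ => 1, fun e => ?_⟩
    have hs : (1 : ℝ) / 32 < Real.sqrt θ := by
      rw [h32]
      exact Real.sqrt_lt_sqrt (by positivity) (by nlinarith)
    have hCs : 32 * π * Real.sqrt θ ≤ C * Real.sqrt θ := mul_le_mul_of_nonneg_right hC32 hsq0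
    have hπs : π ≤ 32 * π * Real.sqrt θ := by nlinarith only [hπ, hs]
    linarith only [harcπ (fun _ => 1) e, hπs, hCs, hcN]
  by_cases hN7 : N ≤ 7
  · -- REGIME B: the trivial gauge, `π ≤ 7π∕N`
    refine ⟨fun _ => 1, fun e => ?_⟩
    have hN7r : (N : ℝ) ≤ 7 := by exact_mod_cast hN7
    have h7 : π ≤ c / (N : ℝ) := by
      rw [le_div_iff₀ hNr]
      nlinarith only [hπ, hN7r, hc7]
    linarith only [harcπ (fun _ => 1) e, h7, hCs0]
  -- REGIME C: `θ ≤ 1∕1024`, `N ≥ 8`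
  have hbig : θ ≤ 1 / 1024 := not_lt.1 hbig
  have hN8 : 8 ≤ N := by omega
  have hsqpos : 0 < Real.sqrt θ := Real.sqrt_pos.2 hθ
  set x : ℝ := 1 / (32 * Real.sqrt θ) with hxdef
  have hx32 : x * (32 * Real.sqrt θ) = 1 := by rw [hxdef]; field_simp
  have hs32 : Real.sqrt θ ≤ 1 / 32 := by
    rw [h32]
    exact Real.sqrt_le_sqrt (by nlinarith)
  have hx1 : 1 ≤ x := by
    rw [hxdef, le_div_iff₀ (by positivity)]
    linarith
  have hx0 : 0 ≤ x := by linarith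
  set ρ : ℕ := ⌊x⌋₊ with hρdef
  have hρ1 : 1 ≤ ρ := Nat.le_floor (by exact_mod_cast hx1)
  have hρ1r : (1 : ℝ) ≤ ρ := by exact_mod_cast hρ1
  have hρx : (ρ : ℝ) ≤ x := Nat.floor_le hx0
  have hxρ : x < ρ + 1 := Nat.lt_floor_add_one x
  have hρpos : (0 : ℝ) < ρ := by linarith
  have hρs : (ρ : ℝ) * Real.sqrt θ ≤ 1 / 32 := by
    have := mul_le_mul_of_nonneg_right hρx hsq0
    linarith only [this, hx32]
  have hinvρ : 1 / (ρ : ℝ) ≤ 64 * Real.sqrt θ := by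
    rw [div_le_iff₀ hρpos]
    have h2ρ : x ≤ 2 * ρ := by linarith only [hxρ, hρ1r]
    have := mul_le_mul_of_nonneg_left h2ρ hsq0
    linarith only [this, hx32]
  have hθsq : Real.sqrt θ * Real.sqrt θ = θ := Real.mul_self_sqrt hθ.le
  have hρθ : (ρ : ℝ) * θ ≤ Real.sqrt θ / 32 := by
    have := mul_le_mul_of_nonneg_right hρs hsq0
    rw [mul_assoc, hθsq] at this
    linarith only [this]
  -- the working scale `ρ′ := min ρ ⌊N∕8⌋`
  set ρ' : ℕ := min ρ (N / 8) with hρ'def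
  have hN8' : 1 ≤ N / 8 := (Nat.le_div_iff_mul_le (by norm_num)).2 (by omega)
  have hρ'1 : 1 ≤ ρ' := le_min hρ1 hN8'
  have hρ'ρ : ρ' ≤ ρ := min_le_left _ _
  have hρ'N : 8 * ρ' ≤ N := by
    have : 8 * (N / 8) ≤ N := Nat.mul_div_le N 8
    have : ρ' ≤ N / 8 := min_le_right _ _
    omega
  have hρ'pos : (0 : ℝ) < ρ' := by exact_mod_cast hρ'1
  have hρ'ρr : (ρ' : ℝ) ≤ ρ := by exact_mod_cast hρ'ρ
  -- `1∕ρ′ ≤ 64√θ + 16∕N`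
  have hinvρ' : 1 / (ρ' : ℝ) ≤ 64 * Real.sqrt θ + 16 / (N : ℝ) := by
    rcases le_total ρ (N / 8) with h | h
    · have : ρ' = ρ := min_eq_left h
      rw [this]
      have : 0 ≤ 16 / (N : ℝ) := by positivity
      linarith
    · have hρ'eq : ρ' = N / 8 := min_eq_right h
      have h16 : 1 / (ρ' : ℝ) ≤ 16 / (N : ℝ) := by
        rw [div_le_div_iff₀ hρ'pos hNr, one_mul]
        have hlt : N < N / 8 * 8 + 8 := Nat.lt_div_mul_add (by norm_num)
        rw [← hρ'eq] at hlt
        have h' : (N : ℝ) < (ρ' : ℝ) * 8 + 8 := by exact_mod_cast hlt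
        have h'' : (1 : ℝ) ≤ (ρ' : ℝ) := by exact_mod_cast hρ'1
        nlinarith only [h', h'']
      have : 0 ≤ 64 * Real.sqrt θ := by positivity
      linarith
  have hd : (F.P J).d = 3 := T3Family.P_d F J
  obtain ⟨M, len, start, owner, hEven, hM8, hlen, hz, hs, hl, hown, hodd⟩ := exists_parityBlocks_oddEq ((F.P J).sitesPerDir 0) ρ' hρ'1 hρ'N
  have hlenN : ∀ i, len i < (F.P J).sitesPerDir 0 := fun i => by have := (hlen i).2; omega
  set g : (Fin (F.P J).d → Fin M) → Site (F.P J) 0 → SU2 :=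
    fun Q => axialT V (fun κ => ((start (Q κ) : ℕ) : ZMod ((F.P J).sitesPerDir 0))) with hgdef
  set δ : ℝ := (4 * ρ' + 6) * θ with hδdef
  have hloc : ∀ (Q : Fin (F.P J).d → Fin M) (b : PBond (F.P J) 0),
      (∀ κ, (b.src κ - ((start (Q κ) : ℕ) : ZMod ((F.P J).sitesPerDir 0))).val ≤ len (Q κ)) →
      (∀ κ, (b.tgt κ - ((start (Q κ) : ℕ) : ZMod ((F.P J).sitesPerDir 0))).val ≤ len (Q κ)) →
      dist1 (GaugeField.gaugeAct (g Q) V b) ≤ δ :=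
    fun Q b hsrc _ => dist1_gaugeAct_axialT_le_of_closedBlock_rho hd hρ'1 hρ'N V hθ.le hV
      (fun κ => ((start (Q κ) : ℕ) : ZMod ((F.P J).sitesPerDir 0))) b.src (fun κ => len (Q κ)) (fun κ => (hlen (Q κ)).2) hsrc b.dir
  have hρρθ : (ρ : ℝ) * ((ρ : ℝ) * θ) ≤ 1 / 32 * (1 / 32) := by
    have hp : (ρ : ℝ) * ((ρ : ℝ) * θ) = ((ρ : ℝ) * Real.sqrt θ) * ((ρ : ℝ) * Real.sqrt θ) := by
      rw [show (ρ : ℝ) * ((ρ : ℝ) * θ) = (ρ : ℝ) * ρ * (Real.sqrt θ * Real.sqrt θ) by rw [hθsq]; ring]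
      ring
    rw [hp]
    exact mul_le_mul hρs hρs (mul_nonneg hρpos.le hsq0) (by norm_num)
  have hη : 2 * δ * ρ' ≤ 1 / 40 := by
    rw [hδdef]
    have hρ'θ0 : 0 ≤ (ρ' : ℝ) * θ := mul_nonneg hρ'pos.le hθ.le
    have hρ'1r : (1 : ℝ) ≤ ρ' := by exact_mod_cast hρ'1
    have hprod : 0 ≤ ((ρ' : ℝ) - 1) * ((ρ' : ℝ) * θ) := mul_nonneg (sub_nonneg.2 hρ'1r) hρ'θ0
    have h1 : 2 * ((4 * (ρ' : ℝ) + 6) * θ) * ρ' ≤ 20 * ((ρ' : ℝ) * ((ρ' : ℝ) * θ)) := by nlinarith only [hprod, hρ'θ0]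
    have h2 : (ρ' : ℝ) * ((ρ' : ℝ) * θ) ≤ (ρ : ℝ) * ((ρ : ℝ) * θ) := by
      have := mul_le_mul hρ'ρr (mul_le_mul_of_nonneg_right hρ'ρr hθ.le) hρ'θ0 hρpos.le
      exact this
    nlinarith only [h1, h2, hρρθ]
  have htrans : ∀ (Q Q' : Fin (F.P J).d → Fin M) (b : PBond (F.P J) 0),
      (∀ κ, (b.src κ - ((start (Q κ) : ℕ) : ZMod ((F.P J).sitesPerDir 0))).val ≤ len (Q κ)) →
      (∀ κ, (b.tgt κ - ((start (Q κ) : ℕ) : ZMod ((F.P J).sitesPerDir 0))).val ≤ len (Q κ)) →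
      (∀ κ, (b.src κ - ((start (Q' κ) : ℕ) : ZMod ((F.P J).sitesPerDir 0))).val ≤ len (Q' κ)) →
      (∀ κ, (b.tgt κ - ((start (Q' κ) : ℕ) : ZMod ((F.P J).sitesPerDir 0))).val ≤ len (Q' κ)) →
      dist1 ((g Q b.src * (g Q' b.src)⁻¹)⁻¹ * (g Q b.tgt * (g Q' b.tgt)⁻¹)) ≤ 2 * δ :=
    fun Q Q' b h1 h2 h3 h4 => dist1_transition_step_le_two_mul (g Q) (g Q') V b (hloc Q b h1 h2) (hloc Q' b h3 h4)
  obtain ⟨w, hcons, hstep⟩ := hSec (F.P J) hd ρ' hρ'1 hρ'N M len start owner hEven hM8 hlen hz hs hl hown hodd g (2 * δ) hη htrans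
  refine ⟨fun x => w (fun κ => owner (x κ)) x * g (fun κ => owner (x κ)) x, fun e => ?_⟩
  have harc' := norm_logVec_glue_le_of_bounds len start owner hown hlenN g w hcons V hloc hstep e
  have hδb : δ ≤ 10 / 32 * Real.sqrt θ := by
    rw [hδdef]
    have hρ'1r' : (1 : ℝ) ≤ ρ' := by exact_mod_cast hρ'1
    nlinarith only [hρθ, hθ.le, hρ'1r', hρ'ρr]
  have hKb : K / ρ' ≤ 64 * K * Real.sqrt θ + 16 * K / (N : ℝ) := by
    have := mul_le_mul_of_nonneg_left hinvρ' hK0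
    calc K / ρ' = K * (1 / ρ') := by ring
      _ ≤ K * (64 * Real.sqrt θ + 16 / (N : ℝ)) := this
      _ = 64 * K * Real.sqrt θ + 16 * K / (N : ℝ) := by ring
  have hCb : π / 2 * (10 / 32 + 64 * K) * Real.sqrt θ ≤ C * Real.sqrt θ := mul_le_mul_of_nonneg_right hCL hsq0
  have hcb : π / 2 * (16 * K / (N : ℝ)) ≤ c / (N : ℝ) := by
    rw [show π / 2 * (16 * K / (N : ℝ)) = (8 * π * K) / (N : ℝ) by ring]
    exact div_le_div_of_nonneg_right hcK hNr.le
  have hπ2 : 0 ≤ π / 2 := by positivity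
  have hsum : δ + K / ρ' ≤ 10 / 32 * Real.sqrt θ + (64 * K * Real.sqrt θ + 16 * K / (N : ℝ)) := by linarith only [hδb, hKb]
  calc ‖logVec (su2Quat (GaugeField.gaugeAct (fun x => w (fun κ => owner (x κ)) x * g (fun κ => owner (x κ)) x) V e))‖
      ≤ π / 2 * (δ + K / ρ') := harc'
    _ ≤ π / 2 * (10 / 32 * Real.sqrt θ + (64 * K * Real.sqrt θ + 16 * K / (N : ℝ))) := mul_le_mul_of_nonneg_left hsum hπ2
    _ = π / 2 * (10 / 32 + 64 * K) * Real.sqrt θ + π / 2 * (16 * K / (N : ℝ)) := by ring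
    _ ≤ C * Real.sqrt θ + c / N := add_le_add hCb hcb


end Summit.QuantumFields.YangMills.Theorems.FluctuationComparisonRegPrIntLS2BetaSqrtGaugeAssemblyOfSectionsOddEq

end
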